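import Literature.NumberTheory.Sieve.BombieriVinogradovMoebius
import HarnessLib

/-!
# Bombieri–Vinogradov for the Möbius function: the form without main term and dilated moduli

Topic `Literature/NumberTheory/Sieve`; everything in this file is PROVED.  General consequences of
the tree's Bombieri–Vinogradov theorem for `μ`
(`Literature.NumberTheory.Sieve.bombieriVinogradov_moebius`, file `BombieriVinogradovMoebius.lean`)
in the shapes consumed by divisor-switching arguments (sums of `μ` over the divisors of the values
of linear forms; Iwaniec–Kowalski, Theorem 17.4 and §17.3):

* `abs_moebiusCoprimeSum_le_uniform` — the subtracted coprime mean
  `∑_{n ≤ N, (n,q)=1} μ(n)` is `≪ 4^{ω(q)} x (log x)^{-B}` uniformly in `N ≤ x` (the tree's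
  `Polymath8a.sum_moebius_coprime_progression_le_uniform` at modulus `1`, fed with
  `Literature.NumberTheory.LFunctions.SiegelWalfiszMoebius_holds`);
* `sum_abs_moebiusAPSum_le` — **Bombieri–Vinogradov for `μ` without main term**:
  `∑_{q ≤ Q} |∑_{n ≤ N_q, n ≡ a_q (q)} μ(n)| ≤ C x (log x)^{-A}` for `Q ≤ x^{1/2}(log x)^{-B}`,
  arbitrary cut-offs `N_q ≤ x` and reduced residues `a_q` (the coprime means summed with
  `∑_{q ≤ Q} 4^{ω(q)}/φ(q) ≤ (1 + log Q)⁸`, `BVMoebius.sum_four_pow_div_totient_le`);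
* `sum_abs_moebiusAPSum_dilate_le` — the same over a dilated family of moduli `k d`, `d ∈ 𝒟`,
  with integer residues (the shape met after a divisor switch, where the modulus is a fixed
  multiple of the switched divisor).

Partial summation against `log`, non-reduced residue classes and the per-modulus bound are in
`MoebiusResidueClassSums.lean` (independent of this file).

## References

* H. Iwaniec, E. Kowalski, *Analytic Number Theory*, AMS Colloquium Publ. 53 (2004), Theorem 17.4
  and §17.3. [IwaniecKowalski2004]
* H. L. Montgomery, R. C. Vaughan, *Multiplicative Number Theory I*, CUP 2007, §11.3.
  [MontgomeryVaughan2007]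
-/

namespace Literature.NumberTheory.Sieve

namespace BVMoebius

open Finset Real ArithmeticFunction
open scoped ArithmeticFunction.Moebius ArithmeticFunction.omega

/-! ### The coprime mean is small (Siegel–Walfisz with a coprimality condition) -/

/-- `|∑_{n ≤ N, (n,q)=1} μ(n)| ≤ C 4^{ω(q)} x (log x)^{-B}` uniformly for `N ≤ x`, `x ≥ 3`, `q ≥ 1`
(the tree's `Polymath8a.sum_moebius_coprime_progression_le_uniform` at modulus `k = 1`, fed with
`SiegelWalfiszMoebius_holds`). [folklore] -/
theorem abs_moebiusCoprimeSum_le_uniform {B : ℝ} (hB : 0 ≤ B) :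
    ∃ C : ℝ, 0 ≤ C ∧ ∀ x : ℝ, 3 ≤ x → ∀ q : ℕ, 1 ≤ q → ∀ N : ℕ, (N : ℝ) ≤ x →
      |moebiusCoprimeSum N q| ≤ C * (4 : ℝ) ^ q.primeFactors.card * x / Real.log x ^ B := by
  obtain ⟨C, hC0, hC⟩ := Polymath8a.sum_moebius_coprime_progression_le_uniform
    LFunctions.SiegelWalfiszMoebius_holds (A := 1) one_pos hB
  refine ⟨C, hC0, fun x hx q hq N hN => ?_⟩
  rcases Nat.eq_zero_or_pos N with rfl | hNpos
  · have : moebiusCoprimeSum 0 q = 0 := by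
      rw [moebiusCoprimeSum, show Icc 1 0 = (∅ : Finset ℕ) by rfl, Finset.filter_empty, sum_empty]
    rw [this, abs_zero]
    have hlog : 0 < Real.log x := Real.log_pos (by linarith)
    positivity
  have hlog1 : (1 : ℝ) ≤ Real.log x := by
    rw [Real.le_log_iff_exp_le (by linarith)]
    have := Real.exp_one_lt_d9
    linarith
  have hk : ((1 : ℕ) : ℝ) ≤ Real.log x ^ (1 : ℝ) := by rw [Real.rpow_one]; exact_mod_cast hlog1
  have hu : IsUnit (0 : ZMod 1) := isUnit_of_subsingleton _
  have h := hC x (by linarith) 1 le_rfl hk 0 hu q (by omega) N (by exact_mod_cast hNpos) hN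
  rw [Nat.floor_natCast] at h
  have hfilter : (Icc 1 N).filter (fun n : ℕ => (n : ZMod 1) = 0 ∧ n.Coprime q) =
      (Icc 1 N).filter (fun n : ℕ => n.Coprime q) := by
    refine Finset.filter_congr fun n _ => ?_
    simp only [and_iff_right_iff_imp]
    exact fun _ => Subsingleton.elim _ _
  rw [hfilter] at h
  exact h

/-! ### Bombieri–Vinogradov for `μ`: the sup over reduced residues, no main term -/

/-- **Bombieri–Vinogradov for `μ` without the subtracted mean**: for every `A > 0` there are
`B > 0`, `C ≥ 0`, `x₀` such that for `x ≥ x₀`, `Q ≤ x^{1/2}(log x)^{-B}`, arbitrary cut-offs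
`N_q ≤ x` and reduced residues `a_q`,
`∑_{q ≤ Q} |∑_{n ≤ N_q, n ≡ a_q (q)} μ(n)| ≤ C x (log x)^{-A}`.
From the tree's `bombieriVinogradov_moebius` and the Siegel–Walfisz bound for the coprime mean
`φ(q)⁻¹ ∑_{n ≤ N, (n,q)=1} μ(n)` summed with `∑_{q ≤ Q} 4^{ω(q)}/φ(q) ≤ (1 + log Q)⁸`.
[cite: IwaniecKowalski2004, Theorem 17.4] -/
theorem sum_abs_moebiusAPSum_le (A : ℝ) (hA : 0 < A) :
    ∃ B C x₀ : ℝ, 0 < B ∧ 0 ≤ C ∧ ∀ x : ℝ, x₀ ≤ x →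
      ∀ Q : ℕ, (Q : ℝ) ≤ x ^ (1 / 2 : ℝ) / Real.log x ^ B →
      ∀ N : ℕ → ℕ, (∀ q, (N q : ℝ) ≤ x) →
      ∀ a : (q : ℕ) → ZMod q, (∀ q ∈ Icc 1 Q, IsUnit (a q)) →
        ∑ q ∈ Icc 1 Q, |moebiusAPSum (N q) q (a q)| ≤ C * x / Real.log x ^ A := by
  obtain ⟨B, C₁, x₀, hB, hC₁, hBV⟩ := bombieriVinogradov_moebius A hA
  obtain ⟨C₂, hC₂0, hSW⟩ := abs_moebiusCoprimeSum_le_uniform (B := A + 8) (by positivity)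
  refine ⟨B, C₁ + C₂, max x₀ 9, hB, by positivity, ?_⟩
  intro x hx Q hQ N hN a ha
  have hx₀ : x₀ ≤ x := le_trans (le_max_left _ _) hx
  have hx9 : (9 : ℝ) ≤ x := le_trans (le_max_right _ _) hx
  have hx0 : 0 < x := by linarith
  have hL2 : 2 ≤ Real.log x := by
    rw [Real.le_log_iff_exp_le hx0]
    have h := Real.exp_one_lt_d9
    have h0 := Real.exp_pos 1
    have : Real.exp 2 < 9 := by
      calc Real.exp 2 = Real.exp 1 * Real.exp 1 := by rw [← Real.exp_add]; norm_num
        _ < 2.7182818286 * 2.7182818286 := mul_lt_mul'' h h h0.le h0.le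
        _ < 9 := by norm_num
    linarith
  have hL0 : 0 < Real.log x := by linarith
  have hL1 : 1 ≤ Real.log x := by linarith
  -- `1 + log Q ≤ log x`
  have hQs : (Q : ℝ) ≤ x ^ (1 / 2 : ℝ) := by
    refine hQ.trans (div_le_self (by positivity) (Real.one_le_rpow hL1 hB.le))
  have hlogQ : 1 + Real.log Q ≤ Real.log x := by
    rcases Nat.eq_zero_or_pos Q with rfl | hQ0
    · simp; linarith
    · have hQ1 : (0 : ℝ) < Q := by exact_mod_cast hQ0
      have h1 : Real.log Q ≤ Real.log (x ^ (1 / 2 : ℝ)) := Real.log_le_log hQ1 hQs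
      rw [Real.log_rpow hx0] at h1
      linarith
  have hlogQ0 : 0 ≤ 1 + Real.log Q := by
    have : 0 ≤ Real.log (Q : ℝ) := Real.log_natCast_nonneg Q; linarith
  -- split `M = Δ + φ⁻¹ · coprime mean`
  have hsplit : ∀ q, |moebiusAPSum (N q) q (a q)| ≤
      |moebiusDisc (N q) q (a q)| + ((Nat.totient q : ℝ))⁻¹ * |moebiusCoprimeSum (N q) q| := by
    intro q
    have hφ : (0 : ℝ) ≤ ((Nat.totient q : ℝ))⁻¹ := inv_nonneg.2 (Nat.cast_nonneg _)
    have e : moebiusAPSum (N q) q (a q) =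
        moebiusDisc (N q) q (a q) + ((Nat.totient q : ℝ))⁻¹ * moebiusCoprimeSum (N q) q := by
      rw [moebiusDisc]; ring
    rw [e]
    refine (abs_add_le _ _).trans ?_
    rw [abs_mul, abs_of_nonneg hφ]
  have h1 : ∑ q ∈ Icc 1 Q, |moebiusDisc (N q) q (a q)| ≤ C₁ * x / Real.log x ^ A :=
    hBV x hx₀ Q hQ N hN a ha
  have h2 : ∑ q ∈ Icc 1 Q, ((Nat.totient q : ℝ))⁻¹ * |moebiusCoprimeSum (N q) q| ≤
      C₂ * x / Real.log x ^ A := by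
    calc ∑ q ∈ Icc 1 Q, ((Nat.totient q : ℝ))⁻¹ * |moebiusCoprimeSum (N q) q|
        ≤ ∑ q ∈ Icc 1 Q, ((Nat.totient q : ℝ))⁻¹ *
            (C₂ * (4 : ℝ) ^ q.primeFactors.card * x / Real.log x ^ (A + 8)) := by
          refine sum_le_sum fun q hq => ?_
          refine mul_le_mul_of_nonneg_left ?_ (inv_nonneg.2 (Nat.cast_nonneg _))
          exact hSW x (by linarith) q (mem_Icc.1 hq).1 (N q) (hN q)
      _ = C₂ * x / Real.log x ^ (A + 8) *
            ∑ q ∈ Icc 1 Q, (4 : ℝ) ^ q.primeFactors.card / Nat.totient q := by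
          rw [mul_sum]
          refine sum_congr rfl fun q _ => ?_
          ring
      _ ≤ C₂ * x / Real.log x ^ (A + 8) * (1 + Real.log Q) ^ 8 := by
          refine mul_le_mul_of_nonneg_left (sum_four_pow_div_totient_le Q) ?_
          have : 0 < Real.log x ^ (A + 8) := Real.rpow_pos_of_pos hL0 _
          positivity
      _ ≤ C₂ * x / Real.log x ^ (A + 8) * Real.log x ^ 8 := by
          refine mul_le_mul_of_nonneg_left (pow_le_pow_left₀ hlogQ0 hlogQ 8) ?_
          have : 0 < Real.log x ^ (A + 8) := Real.rpow_pos_of_pos hL0 _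
          positivity
      _ = C₂ * x / Real.log x ^ A := by
          rw [Real.rpow_add hL0, show ((8 : ℝ)) = ((8 : ℕ) : ℝ) by norm_num, Real.rpow_natCast]
          have : 0 < Real.log x ^ A := Real.rpow_pos_of_pos hL0 _
          have : 0 < Real.log x ^ (8 : ℕ) := pow_pos hL0 _
          field_simp
  calc ∑ q ∈ Icc 1 Q, |moebiusAPSum (N q) q (a q)|
      ≤ ∑ q ∈ Icc 1 Q, (|moebiusDisc (N q) q (a q)| +
          ((Nat.totient q : ℝ))⁻¹ * |moebiusCoprimeSum (N q) q|) := sum_le_sum fun q _ => hsplit q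
    _ = _ := sum_add_distrib
    _ ≤ C₁ * x / Real.log x ^ A + C₂ * x / Real.log x ^ A := add_le_add h1 h2
    _ = (C₁ + C₂) * x / Real.log x ^ A := by ring

/-! ### Dilated moduli -/

/-- `sum_abs_moebiusAPSum_le` over a dilated family of moduli `k d`, `d ∈ 𝒟`, with integer
residues: for `x ≥ x₀`, `k d ≤ x^{1/2}(log x)^{-B}` on `𝒟`, cut-offs `t_d ≤ x` and
`(a_d, k d) = 1`, `∑_{d ∈ 𝒟} |∑_{n ≤ t_d, n ≡ a_d (k d)} μ(n)| ≤ C x (log x)^{-A}`. [folklore] -/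
theorem sum_abs_moebiusAPSum_dilate_le (A : ℝ) (hA : 0 < A) :
    ∃ B C x₀ : ℝ, 0 < B ∧ 0 ≤ C ∧ ∀ x : ℝ, x₀ ≤ x → ∀ k : ℕ, 0 < k →
      ∀ 𝒟 : Finset ℕ, (∀ d ∈ 𝒟, 1 ≤ d ∧ ((k * d : ℕ) : ℝ) ≤ x ^ (1 / 2 : ℝ) / Real.log x ^ B) →
      ∀ t : ℕ → ℕ, (∀ d, (t d : ℝ) ≤ x) →
      ∀ a : ℕ → ℕ, (∀ d ∈ 𝒟, (a d).Coprime (k * d)) →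
        ∑ d ∈ 𝒟, |moebiusAPSum (t d) (k * d) ((a d : ℕ) : ZMod (k * d))| ≤
          C * x / Real.log x ^ A := by
  classical
  obtain ⟨B, C, x₀, hB, hC, h⟩ := sum_abs_moebiusAPSum_le A hA
  refine ⟨B, C, max x₀ 1, hB, hC, ?_⟩
  intro x hx k hk 𝒟 h𝒟 t ht a ha
  have hx₀ : x₀ ≤ x := le_trans (le_max_left _ _) hx
  have hx1 : 1 ≤ x := le_trans (le_max_right _ _) hx
  have hlog : 0 ≤ Real.log x := Real.log_nonneg hx1
  have hlev0 : 0 ≤ x ^ (1 / 2 : ℝ) / Real.log x ^ B :=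
    div_nonneg (Real.rpow_nonneg (by linarith) _) (Real.rpow_nonneg hlog _)
  set Q := ⌊x ^ (1 / 2 : ℝ) / Real.log x ^ B⌋₊ with hQdef
  have hQ : (Q : ℝ) ≤ x ^ (1 / 2 : ℝ) / Real.log x ^ B := Nat.floor_le hlev0
  set 𝓛 := 𝒟.image (fun d => k * d) with h𝓛def
  have h𝓛 : 𝓛 ⊆ Icc 1 Q := by
    intro L hL
    obtain ⟨d, hd, rfl⟩ := mem_image.1 hL
    rw [mem_Icc]
    refine ⟨Nat.mul_pos hk (h𝒟 d hd).1, ?_⟩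
    rw [Nat.le_floor_iff hlev0]
    exact (h𝒟 d hd).2
  set t' : ℕ → ℕ := fun L => t (L / k) with ht'def
  set a' : (q : ℕ) → ZMod q := fun L => if L ∈ 𝓛 then ((a (L / k) : ℕ) : ZMod L) else 1
    with ha'def
  have hsum : ∑ d ∈ 𝒟, |moebiusAPSum (t d) (k * d) ((a d : ℕ) : ZMod (k * d))| =
      ∑ L ∈ 𝓛, |moebiusAPSum (t' L) L (a' L)| := by
    rw [h𝓛def, sum_image (fun d₁ _ d₂ _ hd => Nat.eq_of_mul_eq_mul_left hk hd)]
    refine sum_congr rfl fun d hd => ?_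
    have hkd : k * d / k = d := Nat.mul_div_cancel_left d hk
    have hmem : k * d ∈ 𝓛 := mem_image_of_mem _ hd
    simp only [ht'def, ha'def, hkd]
    rw [if_pos hmem]
  rw [hsum]
  calc ∑ L ∈ 𝓛, |moebiusAPSum (t' L) L (a' L)|
      ≤ ∑ L ∈ Icc 1 Q, |moebiusAPSum (t' L) L (a' L)| :=
        sum_le_sum_of_subset_of_nonneg h𝓛 fun _ _ _ => abs_nonneg _
    _ ≤ C * x / Real.log x ^ A := by
        refine h x hx₀ Q hQ t' (fun L => ht _) a' fun L _ => ?_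
        by_cases hL : L ∈ 𝓛
        · obtain ⟨d, hd, rfl⟩ := mem_image.1 hL
          have hkd : k * d / k = d := Nat.mul_div_cancel_left d hk
          simp only [ha'def, if_pos hL, hkd]
          exact (ZMod.isUnit_iff_coprime _ _).2 (ha d hd)
        · simp only [ha'def, if_neg hL]
          exact isUnit_one

end BVMoebius

end Literature.NumberTheory.Sieve
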